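import Summits.AtomisticToContinuum.FouriersLaw.Theses.PhononMeanFreePath

/-!
# CoherentDephasing — load-bearing hypotheses (negative-side support)

Support lemmas for crux `PhononMeanFreePath.CoherentDephasing` (item stmt-AtomisticToContinuum-11810)
from the standing disprover's work file `Cruxes/CoherentDephasing/Disproof.lean` §1–§3, all
sorry-free:

* `0 < T` is NOT load-bearing at the Lean level: for `T ≤ 0` the Gibbs measure of the `(n+1)`-site
  pinned chain is the ZERO measure (`pinnedChain_gibbsMeasure_succ_eq_zero_of_nonpos`; the density
  `e^{-H/T} ≥ 1` is not integrable on an infinite-volume phase space), so the pair correlation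
  `r_N ≡ 0` there and the `T`-slice of the crux holds trivially; hence the crux is EQUIVALENT to
  its version with `0 < T` dropped (`coherentDephasing_iff_allT`). No counterexample lives at
  `T ≤ 0`, and no case split on the sign of `T` helps a proof.
* Anharmonicity IS load-bearing, modulo the route's calibration item: weakening `0 < lam, 0 < β`
  to `0 ≤ lam, 0 ≤ β` admits the harmonic corner, where `HarmonicCoherentPersistence`
  (stmt-11814, Rieder–Lebowitz–Lieb ballistic transport) says `N ∫ r_N² ↛ 0`
  (`crux_false_without_anharmonicity_of_persistence`, pure logic).
-/

noncomputable section

open MeasureTheory Filter Topology Set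
open Literature.MathematicalPhysics.KineticTheory.HeatConduction
open Summit.AtomisticToContinuum.FouriersLaw.Theses.PhononMeanFreePath

namespace Summit.AtomisticToContinuum.FouriersLaw.Theorems.CoherentDephasing.Negative.LoadBearing

/-! ## 1. Zero Gibbs measure for `T ≤ 0` -/

/-- Lebesgue measure of the phase space of `n + 1` oscillators is infinite. [folklore] -/
theorem volume_phaseSpace_succ_univ (n : ℕ) : (volume : Measure (PhaseSpace (n + 1))) univ = ⊤ := by
  rw [MeasureTheory.Measure.volume_eq_prod, ← univ_prod_univ, Measure.prod_prod]
  have h : (volume : Measure (Fin (n + 1) → ℝ)) univ = ⊤ := by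
    rw [volume_pi, ← Set.pi_univ, Measure.pi_pi]
    simp
  rw [h]
  simp

/-- The energy of the pinned chain is nonnegative for `ω₂, lam, β ≥ 0`. [folklore] -/
theorem pinnedChain_hamiltonian_nonneg {ω₂ lam β : ℝ} (γ : ℝ) (hω : 0 ≤ ω₂) (hl : 0 ≤ lam)
    (hβ : 0 ≤ β) (n : ℕ) (x : PhaseSpace n) : 0 ≤ (pinnedChain ω₂ lam β γ).hamiltonian n x := by
  unfold OscillatorChain.hamiltonian
  refine add_nonneg (Finset.sum_nonneg fun i _ => ?_)
    (Finset.sum_nonneg fun i _ => Finset.sum_nonneg fun j _ => ?_)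
  · simp only [pinnedChain]; positivity
  · split_ifs
    · simp only [pinnedChain]; positivity
    · exact le_rfl

/-- For `T ≤ 0` (and `ω₂, lam, β ≥ 0`) the Gibbs density `e^{-H/T} ≥ 1` is not Lebesgue integrable
on the phase space of `n + 1` sites (`x / 0 = 0` makes the `T = 0` density the constant `1`).
[folklore] -/
theorem pinnedChain_not_integrable_gibbsDensity_of_nonpos {ω₂ lam β : ℝ} (γ : ℝ) (hω : 0 ≤ ω₂)
    (hl : 0 ≤ lam) (hβ : 0 ≤ β) (n : ℕ) {T : ℝ} (hT : T ≤ 0) :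
    ¬ Integrable ((pinnedChain ω₂ lam β γ).gibbsDensity (n + 1) T) := by
  intro hint
  have hge : ∀ x, (1 : ℝ) ≤ (pinnedChain ω₂ lam β γ).gibbsDensity (n + 1) T x := by
    intro x
    have hH := pinnedChain_hamiltonian_nonneg γ hω hl hβ (n + 1) x
    have harg : 0 ≤ -(pinnedChain ω₂ lam β γ).hamiltonian (n + 1) x / T := by
      rcases eq_or_lt_of_le hT with h0 | hneg
      · simp [h0]
      · exact div_nonneg_of_nonpos (by linarith) hneg.le
    simpa [OscillatorChain.gibbsDensity] using Real.one_le_exp harg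
  have hone : Integrable (fun _ : PhaseSpace (n + 1) => (1 : ℝ)) := by
    refine hint.mono' aestronglyMeasurable_const (Filter.Eventually.of_forall fun x => ?_)
    rw [Real.norm_eq_abs, abs_one]
    exact hge x
  rcases integrable_const_iff.1 hone with h | h
  · exact one_ne_zero h
  · have hlt := @measure_lt_top _ _ (volume : Measure (PhaseSpace (n + 1))) h univ
    rw [volume_phaseSpace_succ_univ] at hlt
    exact lt_irrefl _ hlt

/-- **Zero Gibbs measure at `T ≤ 0`**: for `ω₂, lam, β ≥ 0` and `T ≤ 0` the Gibbs measure of the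
`(n+1)`-site pinned chain is the zero measure (Mathlib's `tilted` convention). [folklore] -/
theorem pinnedChain_gibbsMeasure_succ_eq_zero_of_nonpos {ω₂ lam β : ℝ} (γ : ℝ) (hω : 0 ≤ ω₂)
    (hl : 0 ≤ lam) (hβ : 0 ≤ β) (n : ℕ) {T : ℝ} (hT : T ≤ 0) :
    (pinnedChain ω₂ lam β γ).gibbsMeasure (n + 1) T = 0 :=
  (pinnedChain ω₂ lam β γ).gibbsMeasure_of_not_integrable
    (pinnedChain_not_integrable_gibbsDensity_of_nonpos γ hω hl hβ n hT)

/-- At `T ≤ 0` the crux's pair correlation `r_N(t) = ∫ p₀ · (K_t p_N) dμ_T` vanishes identically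
(integral against the zero measure), whatever the kernel. [folklore] -/
theorem pairCorr_eq_zero_of_nonpos {ω₂ lam β : ℝ} (γ : ℝ) (hω : 0 ≤ ω₂) (hl : 0 ≤ lam)
    (hβ : 0 ≤ β) {T : ℝ} (hT : T ≤ 0) (N : ℕ) (t : ℝ) :
    (∫ z, z.2 0 * (∫ y, y.2 (Fin.last N)
      ∂((pinnedChain ω₂ lam β γ).transitionKernel (N + 1) T T t.toNNReal z))
      ∂((pinnedChain ω₂ lam β γ).gibbsMeasure (N + 1) T)) = 0 := by
  rw [pinnedChain_gibbsMeasure_succ_eq_zero_of_nonpos γ hω hl hβ N hT, integral_zero_measure]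

/-! ## 2. `0 < T` is not load-bearing -/

/-- **The crux is equivalent to its version with the hypothesis `0 < T` dropped**: the slices
`T ≤ 0` are junk-true (zero Gibbs measure ⇒ `r_N ≡ 0` ⇒ `0` is integrable and `N · 0 → 0`).
[folklore] -/
theorem coherentDephasing_iff_allT :
    CoherentDephasing ↔
      ∀ ω₂ lam β γ : ℝ, 0 < ω₂ → 0 < lam → 0 < β → 0 < γ → ∀ T : ℝ,
        (∀ N : ℕ, IntegrableOn (fun t : ℝ => (∫ z, z.2 0 * (∫ y, y.2 (Fin.last N)
          ∂((pinnedChain ω₂ lam β γ).transitionKernel (N + 1) T T t.toNNReal z))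
          ∂((pinnedChain ω₂ lam β γ).gibbsMeasure (N + 1) T)) ^ 2) (Ioi 0)) ∧
        Tendsto (fun N : ℕ => (N : ℝ) * ∫ t in Ioi (0 : ℝ), (∫ z, z.2 0 * (∫ y, y.2 (Fin.last N)
          ∂((pinnedChain ω₂ lam β γ).transitionKernel (N + 1) T T t.toNNReal z))
          ∂((pinnedChain ω₂ lam β γ).gibbsMeasure (N + 1) T)) ^ 2) atTop (𝓝 0) := by
  refine ⟨fun h ω₂ lam β γ hω hl hβ hγ T => ?_, fun h ω₂ lam β γ hω hl hβ hγ T _ => h ω₂ lam β γ hω hl hβ hγ T⟩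
  by_cases hT : 0 < T
  · exact h ω₂ lam β γ hω hl hβ hγ T hT
  · have h0 := pairCorr_eq_zero_of_nonpos γ hω.le hl.le hβ.le (not_lt.1 hT)
    refine ⟨fun N => ?_, ?_⟩
    · simp only [h0]
      simp
    · simp only [h0]
      simp

/-! ## 3. Anharmonicity is load-bearing (modulo the harmonic calibration item) -/

/-- **Weakening `0 < lam, 0 < β` to `0 ≤ lam, 0 ≤ β` makes the crux false, given
`HarmonicCoherentPersistence`** (stmt-11814: for the pinned HARMONIC chain `N ∫ r_N² ↛ 0` —
Rieder–Lebowitz–Lieb/Landauer ballistic conductance `2γ²T⁻² ∫ r_N² → c_∞ > 0`; true in substance,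
awaiting the identification of `transitionKernel` at `lam = β = 0` with the Ornstein–Uhlenbeck law).
Pure logic: the harmonic corner `(ω₂, 0, 0, γ)` is admitted by the weakened hypotheses. So any
proof of the crux must USE `0 < lam ∨ 0 < β`. [cite: RiederLebowitzLieb1967] -/
theorem crux_false_without_anharmonicity_of_persistence (h : HarmonicCoherentPersistence) :
    ¬ ∀ ω₂ lam β γ : ℝ, 0 < ω₂ → 0 ≤ lam → 0 ≤ β → 0 < γ → ∀ T : ℝ, 0 < T →
        (∀ N : ℕ, IntegrableOn (fun t : ℝ => (∫ z, z.2 0 * (∫ y, y.2 (Fin.last N)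
          ∂((pinnedChain ω₂ lam β γ).transitionKernel (N + 1) T T t.toNNReal z))
          ∂((pinnedChain ω₂ lam β γ).gibbsMeasure (N + 1) T)) ^ 2) (Ioi 0)) ∧
        Tendsto (fun N : ℕ => (N : ℝ) * ∫ t in Ioi (0 : ℝ), (∫ z, z.2 0 * (∫ y, y.2 (Fin.last N)
          ∂((pinnedChain ω₂ lam β γ).transitionKernel (N + 1) T T t.toNNReal z))
          ∂((pinnedChain ω₂ lam β γ).gibbsMeasure (N + 1) T)) ^ 2) atTop (𝓝 0) := by
  intro hA
  obtain ⟨_, hnot⟩ := h 1 1 one_pos one_pos 1 one_pos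
  exact hnot (hA 1 0 0 1 one_pos le_rfl le_rfl one_pos 1 one_pos).2

end Summit.AtomisticToContinuum.FouriersLaw.Theorems.CoherentDephasing.Negative.LoadBearing
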